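import Literature.NumberTheory.QuadraticFields.QuadraticDedekindZeta
import HarnessLib

/-!
# Twisting the Dedekind zeta function of a quadratic field by a Dirichlet character:
# `Σ_𝔞 ψ(N𝔞) N𝔞^{−s} = L(s, ψ) · L(s, ψ χ_{d_K})`

Topic `NumberTheory/QuadraticFields`, namespace `Literature.NumberTheory.QuadraticFields.Quadratic`
(continuing `QuadraticDedekindZeta.lean`). Everything here is PROVED (theorems only, no named facts).

For a number field `K` and a Dirichlet character `ψ` modulo `N`, the twisted Dedekind zeta function
`Z(s, ψ) = Σ_{𝔞 ≠ 0} ψ(N𝔞) N𝔞^{−s}` converges absolutely for `Re s > 1` and has the Euler product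
`∏_𝔭 (1 − ψ(N𝔭) N𝔭^{−s})⁻¹` (`hasProd_twistedEulerFactor`; Neukirch, *Algebraic Number Theory*,
VII (5.2) and its proof via (1.1), exactly as for `ψ = 1` in `LFunctions/DedekindZetaProofs.lean`,
whose abstract Euler product `FinsuppEulerProduct.hasProd_inv_one_sub` and unique-factorisation
bijection we reuse). For `K` quadratic with odd discriminant the local factors
(`finprod_primesOver_eq` with `f(n) = ψ(n) n^{−s}`) give

* **`tsum_twist_eq_LSeries_mul_LSeries`**: `Σ_𝔞 ψ(N𝔞) N𝔞^{−s} = L(s, ψ) · L(s, ψχ_{d_K})` for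
  `Re s > 1`, where `L(s, ψχ_{d_K}) = Σ ψ(n) χ_{d_K}(n) n^{−s}`.

This is identity (1) of Baker, *Transcendental Number Theory*, Ch. 5 §2 (p. 48 of the held copy:
"`L(s, χ) L(s, χχ') = ½ Σ_f Σ_{x,y} χ(f) f^{−s}`", there written over the forms of discriminant
`−d`; the passage from ideals to forms for class number one is made in a sequel), the starting point
of the Gelfond–Linnik–Baker treatment of the class number one problem.

## References

* [NeukirchANT1999] J. Neukirch, *Algebraic Number Theory* (1999), Ch. VII §5 (5.2), §1 (1.1).
* [Baker1975] A. Baker, *Transcendental Number Theory* (1975), Ch. 5 §2, eq. (1) (p. 48).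
-/

noncomputable section

open Module NumberField Ideal IsDedekindDomain IsDedekindDomain.HeightOneSpectrum
open scoped NumberTheorySymbols

namespace Literature.NumberTheory.QuadraticFields.Quadratic

/-! ### The twisted Euler product over the primes of `𝓞 K` (any number field) -/

section Twist

variable (K : Type*) [Field K] [NumberField K] {N : ℕ}

/-- Absolute convergence of `Σ_𝔞 ψ(N𝔞) N𝔞^{−s}` for `Re s > 1` (domination by `Σ_𝔞 N𝔞^{−Re s}`,
`|ψ| ≤ 1`). [cite: NeukirchANT1999, Ch. VII §5 (5.2)] -/
theorem summable_norm_twist (ψ : DirichletCharacter ℂ N) {s : ℂ} (hs : 1 < s.re) :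
    Summable fun I : Ideal (𝓞 K) => ‖ψ (absNorm I) * ((absNorm I : ℕ) : ℂ) ^ (-s)‖ := by
  refine (Literature.NumberTheory.LFunctions.summable_norm_absNorm_cpow K hs).of_nonneg_of_le
    (fun I => norm_nonneg _) fun I => ?_
  rw [norm_mul]
  exact mul_le_of_le_one_left (norm_nonneg _) (ψ.norm_le_one _)

/-- **Euler product of the twisted Dedekind zeta function**: for a Dirichlet character `ψ` and
`Re s > 1`, `∏_𝔭 (1 − ψ(N𝔭) N𝔭^{−s})⁻¹` converges unconditionally (over the nonzero primes of
`𝓞 K`) to `Σ_𝔞 ψ(N𝔞) N𝔞^{−s}` (the zero ideal contributing `0`). The proof is that of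
`Literature.NumberTheory.LFunctions.hasProd_dedekindEulerFactor_holds` with `n^{−s}` replaced by the
completely multiplicative `ψ(n) n^{−s}` (`dirichletSummandHom`). [cite: NeukirchANT1999, Ch. VII §5 (5.2)] -/
theorem hasProd_twistedEulerFactor (ψ : DirichletCharacter ℂ N) {s : ℂ} (hs : 1 < s.re) :
    HasProd (fun v : HeightOneSpectrum (𝓞 K) =>
        (1 - ψ (absNorm v.asIdeal) * ((absNorm v.asIdeal : ℕ) : ℂ) ^ (-s))⁻¹)
      (∑' I : Ideal (𝓞 K), ψ (absNorm I) * ((absNorm I : ℕ) : ℂ) ^ (-s)) := by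
  have hs0 : s ≠ 0 := fun h => by rw [h, Complex.zero_re] at hs; linarith
  set φ : ℕ →*₀ ℂ := dirichletSummandHom ψ hs0 with hφdef
  have hφ : ∀ n : ℕ, φ n = ψ n * (n : ℂ) ^ (-s) := fun n => rfl
  -- `φ ∘ N` is multiplicative on ideals
  have hkey : ∀ g : HeightOneSpectrum (𝓞 K) →₀ ℕ,
      φ (absNorm (g.prod fun v k => v.asIdeal ^ k)) = g.prod fun v k => (φ (absNorm v.asIdeal)) ^ k := by
    intro g
    let θ : Ideal (𝓞 K) →* ℂ := φ.toMonoidHom.comp (Ideal.absNorm : Ideal (𝓞 K) →*₀ ℕ).toMonoidHom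
    have hθ : ∀ I, θ I = φ (absNorm I) := fun I => rfl
    rw [← hθ, map_finsuppProd]
    simp only [map_pow, hθ]
  have hinj := Literature.NumberTheory.LFunctions.finsuppProd_asIdeal_pow_injective (R := 𝓞 K)
  have hsumg : Summable fun g : HeightOneSpectrum (𝓞 K) →₀ ℕ =>
      ‖g.prod fun v k => (φ (absNorm v.asIdeal)) ^ k‖ := by
    simp only [← hkey]
    exact (summable_norm_twist K ψ hs).comp_injective hinj
  have hP := Literature.NumberTheory.LFunctions.FinsuppEulerProduct.hasProd_inv_one_sub hsumg
  have htsum : (∑' g : HeightOneSpectrum (𝓞 K) →₀ ℕ, g.prod fun v k => (φ (absNorm v.asIdeal)) ^ k) =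
      ∑' I : Ideal (𝓞 K), φ (absNorm I) := by
    simp only [← hkey]
    rw [hinj.tsum_eq (f := fun I : Ideal (𝓞 K) => φ (absNorm I)) ?_]
    intro I hI
    refine Literature.NumberTheory.LFunctions.mem_range_finsuppProd_asIdeal_pow_iff.mpr fun h => ?_
    rw [Function.mem_support, h, Submodule.zero_eq_bot, Ideal.absNorm_bot, map_zero] at hI
    exact hI rfl
  rw [htsum] at hP
  exact hP

end Twist

/-! ### Products of Dirichlet characters of different moduli -/

section Characters

variable {N q : ℕ} [NeZero N] [NeZero q]

/-- The product of `ψ (mod N)` and `χ (mod q)` as a Dirichlet character modulo `N q` takes the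
values `ψ(n) χ(n)` at every natural number `n`. [folklore] -/
theorem changeLevel_mul_changeLevel_natCast (ψ : DirichletCharacter ℂ N) (χ : DirichletCharacter ℂ q)
    (n : ℕ) :
    (DirichletCharacter.changeLevel (dvd_mul_right N q) ψ *
        DirichletCharacter.changeLevel (dvd_mul_left q N) χ) (n : ZMod (N * q)) = ψ n * χ n := by
  haveI : NeZero (N * q) := ⟨mul_ne_zero (NeZero.ne N) (NeZero.ne q)⟩
  rw [MulChar.coeToFun_mul, Pi.mul_apply]
  by_cases hu : IsUnit (n : ZMod (N * q))
  · obtain ⟨u, hu⟩ := hu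
    rw [← hu, DirichletCharacter.changeLevel_eq_cast_of_dvd, DirichletCharacter.changeLevel_eq_cast_of_dvd,
      hu, ZMod.cast_natCast (dvd_mul_right N q), ZMod.cast_natCast (dvd_mul_left q N)]
  · -- `gcd(n, Nq) ≠ 1`: both sides vanish
    rw [MulChar.map_nonunit _ hu, MulChar.map_nonunit _ hu, zero_mul]
    have hcop : ¬ n.Coprime (N * q) := fun h => hu ((ZMod.isUnit_iff_coprime n (N * q)).mpr h)
    by_cases hN : n.Coprime N
    · have hq : ¬ n.Coprime q := fun h => hcop (Nat.Coprime.mul_right hN h)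
      rw [MulChar.map_nonunit χ (mt (ZMod.isUnit_iff_coprime n q).mp hq), mul_zero]
    · rw [MulChar.map_nonunit ψ (mt (ZMod.isUnit_iff_coprime n N).mp hN), zero_mul]

end Characters

/-! ### `Σ_𝔞 ψ(N𝔞) N𝔞^{−s} = L(s, ψ) L(s, ψχ_{d_K})` for a quadratic field -/

section Quadratic

variable {K : Type*} [Field K] [NumberField K] {N : ℕ} [NeZero N]

/-- **The twisted Dedekind zeta function of a quadratic field with odd discriminant**: for a
Dirichlet character `ψ` modulo `N` and `Re s > 1`,
`Σ_𝔞 ψ(N𝔞) N𝔞^{−s} = L(s, ψ) · L(s, ψχ_{d_K})`, with `L(s, ψχ_{d_K}) = Σ_n ψ(n) χ_{d_K}(n) n^{−s}`,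
`χ_{d_K} = (· / |d_K|)`: the twisted Euler product `hasProd_twistedEulerFactor` regrouped by
rational primes, the local factors `finprod_primesOver_eq` with `f(n) = ψ(n) n^{−s}`, and the Euler
products of the two Dirichlet `L`-series (Mathlib, the second for the product character modulo
`N |d_K|`). This is identity (1) of Baker 1975, Ch. 5 §2, in ideal-theoretic form.
[cite: Baker1975, Ch. 5 §2 eq. (1)] -/
theorem tsum_twist_eq_LSeries_mul_LSeries (h2 : finrank ℚ K = 2) (hodd : Odd (NumberField.discr K))
    (ψ : DirichletCharacter ℂ N) {s : ℂ} (hs : 1 < s.re) :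
    (∑' I : Ideal (𝓞 K), ψ (absNorm I) * ((absNorm I : ℕ) : ℂ) ^ (-s)) =
      LSeries (fun n => ψ n) s *
        LSeries (fun n => ψ n * jacobiChar (NumberField.discr K).natAbs n) s := by
  have hs0 : s ≠ 0 := fun h => by rw [h, Complex.zero_re] at hs; linarith
  set f : ℕ →* ℂ := (dirichletSummandHom ψ hs0 : ℕ →* ℂ) with hfdef
  have hf : ∀ n : ℕ, f n = ψ n * (n : ℂ) ^ (-s) := fun n => rfl
  set G : Ideal (𝓞 K) → ℂ := fun P => (1 - f (absNorm P))⁻¹ with hG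
  -- the twisted Euler product, regrouped by rational primes
  have h1 : HasProd (fun v : HeightOneSpectrum (𝓞 K) => G v.asIdeal)
      (∑' I : Ideal (𝓞 K), ψ (absNorm I) * ((absNorm I : ℕ) : ℂ) ^ (-s)) :=
    hasProd_twistedEulerFactor K ψ hs
  have h2' := Literature.NumberTheory.NumberFields.HasProd.primesOver_regroup h1
  -- the product character `ψ χ` modulo `N q`
  haveI : NeZero (N * (NumberField.discr K).natAbs) :=
    ⟨mul_ne_zero (NeZero.ne N) (NeZero.ne (NumberField.discr K).natAbs)⟩
  set ψχ : DirichletCharacter ℂ (N * (NumberField.discr K).natAbs) :=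
    DirichletCharacter.changeLevel (dvd_mul_right N (NumberField.discr K).natAbs) ψ *
      DirichletCharacter.changeLevel (dvd_mul_left (NumberField.discr K).natAbs N)
        (jacobiChar (NumberField.discr K).natAbs) with hψχ
  have hval : ∀ n : ℕ, ψχ (n : ZMod (N * (NumberField.discr K).natAbs)) =
      ψ n * jacobiChar (NumberField.discr K).natAbs n :=
    changeLevel_mul_changeLevel_natCast ψ (jacobiChar (NumberField.discr K).natAbs)
  have h3 : (fun p : Nat.Primes => ∏ᶠ P ∈ primesOver (span {((p : ℕ) : ℤ)}) (𝓞 K), G P) =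
      fun p : Nat.Primes => (1 - ψ ((p : ℕ) : ZMod N) * ((p : ℕ) : ℂ) ^ (-s))⁻¹ *
        (1 - ψχ ((p : ℕ) : ZMod (N * (NumberField.discr K).natAbs)) * ((p : ℕ) : ℂ) ^ (-s))⁻¹ := by
    funext p
    rw [hG]
    dsimp only
    rw [finprod_primesOver_eq h2 hodd f p.2, hf, hval]
    ring_nf
  rw [h3] at h2'
  -- the Euler products of `L(·, ψ)` and `L(·, ψχ)`
  have h4 := (DirichletCharacter.LSeries_eulerProduct_hasProd ψ hs).mul
    (DirichletCharacter.LSeries_eulerProduct_hasProd ψχ hs)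
  rw [h2'.unique h4]
  congr 1
  exact LSeries_congr (fun {n} _ => hval n) s

/-- The product `ψ · (· / q)` of a Dirichlet character and a Jacobi character, when `ψ = (· / k)` is
itself a Jacobi character, is the Jacobi character modulo `k q`: `J(n | k) J(n | q) = J(n | kq)`.
[folklore] -/
theorem jacobiChar_mul_jacobiChar_natCast {k q : ℕ} [NeZero k] [NeZero q] (n : ℕ) :
    jacobiChar k n * jacobiChar q n = @jacobiChar (k * q) ⟨mul_ne_zero (NeZero.ne k) (NeZero.ne q)⟩ n := by
  haveI : NeZero (k * q) := ⟨mul_ne_zero (NeZero.ne k) (NeZero.ne q)⟩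
  rw [jacobiChar_natCast, jacobiChar_natCast,
    show @jacobiChar (k * q) ⟨mul_ne_zero (NeZero.ne k) (NeZero.ne q)⟩ = jacobiChar (k * q) from rfl,
    jacobiChar_natCast, jacobiSym.mul_right' (n : ℤ) (NeZero.ne k) (NeZero.ne q), Int.cast_mul]

end Quadratic

end Literature.NumberTheory.QuadraticFields.Quadratic
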